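import Literature.NumberTheory.Transcendental.CurvePeriodsPathHomotopicProofs
import Mathlib.Analysis.SpecialFunctions.SmoothTransition
import HarnessLib

/-!
# Periods of curve type: every continuous path is homotopic to a `C¹` path

Companion of `Literature/NumberTheory/Transcendental/CurvePeriods.lean` (Huber–Wüstholz 2022,
Thm. 13.3 (2), rendered on explicit period symbols `(Z, ω, γ)`; the general statement is the
named fact `HuberWustholzCurvePeriods`). The rendering represents classes of
`H₁^sing(Z^an, D; ℚ)` by `C¹` paths with algebraic end points (§3.3.1 of the book: "we can use
`C^∞`-cochains …; up to homotopy such a cycle can be replaced by …"). This file proves the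
underlying approximation statement for an arbitrary embedded smooth affine curve `Z` over `ℚ̄`:

* `exists_curvePath_of_path` — **every continuous path `p : Path x y` in `Z(ℂ)` between
  algebraic points is homotopic, with fixed end points, to a `C¹` path** (a `CurvePath`):
  cover `p` by holomorphic chart discs (`exists_localChart`, Lebesgue number), replace the piece
  of `p` over `[r/N, (r+1)/N]` by the chart-straight segment between its end points,
  parametrised by `Real.smoothTransition (N t − r)` (flat at both ends, so that the pieces add up
  — literally: `γ = x + Σ_r (piece_r − p(r/N))`, a finite sum of globally `C¹` maps — to a `C¹`
  path), and contract each piece onto its replacement inside the chart disc (straight-line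
  homotopy in the chart coordinate);
* consequences with `CurvePeriodsPathHomotopicProofs`: `span_single_sub_single_of_freelyHomotopic`
  — **freely homotopic `C¹` loops have the same symbol** (the base point may move along an
  arbitrary continuous path), and `exists_curvePath_symbol_of_path` — every continuous path
  between algebraic points HAS a symbol, well defined modulo the elementary relations.

## References

* A. Huber, G. Wüstholz, *Transcendence and Linear Relations of 1-Periods*, Cambridge Tracts in
  Mathematics 227, CUP 2022 [HuberWustholz2022]: §3.3.1 (pp. 42–44 of the held text), Thm. 13.3 (2)
  (p. 121).
-/

noncomputable section

open scoped BigOperators Topology unitInterval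
open MvPolynomial Set Filter Metric

namespace Literature.NumberTheory.Transcendental

namespace CurvePeriods

set_option quotPrecheck false in
/-- Membership in the `ℚ̄`-span of the elementary relations, in the format of the conclusion of
`HuberWustholzCurvePeriods`. -/
local notation "InSpan" c:max => ∃ (k : ℕ) (ρ : Fin k → (PeriodSymbol →₀ ℂ)) (a : Fin k → ℂ),
  (∀ l, IsElementaryRelation (ρ l)) ∧ (∀ l, IsAlgebraic ℚ (a l)) ∧ c = ∑ l, a l • ρ l

variable {Z : CurveData}

/-! ### Arithmetic of the subdivision -/

/-- Telescoping evaluation: if `f r = P (r+1)` for `r < k` and `f r = P r` for `k < r < N`, then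
`P 0 + Σ_{r<N} (f r − P r) = f k`. [folklore] -/
theorem telescope_eval {M : Type*} [AddCommGroup M] (P f : ℕ → M) {N k : ℕ} (hk : k < N)
    (hlt : ∀ r, r < k → f r = P (r + 1)) (hgt : ∀ r, k < r → r < N → f r = P r) :
    P 0 + ∑ r ∈ Finset.range N, (f r - P r) = f k := by
  rw [← Finset.sum_range_add_sum_Ico _ (Nat.succ_le_of_lt hk), Finset.sum_range_succ]
  have h1 : ∑ r ∈ Finset.range k, (f r - P r) = P k - P 0 := by
    rw [← Finset.sum_range_sub P k]
    exact Finset.sum_congr rfl fun r hr => by rw [hlt r (Finset.mem_range.mp hr)]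
  have h2 : ∑ r ∈ Finset.Ico (k + 1) N, (f r - P r) = 0 :=
    Finset.sum_eq_zero fun r hr => by
      rw [Finset.mem_Ico] at hr
      rw [hgt r (Nat.lt_of_succ_le hr.1) hr.2, sub_self]
  rw [h1, h2, add_zero]
  abel

/-- Every `t ∈ [0,1]` lies in some `[k/N, (k+1)/N]`, `k < N`. [folklore] -/
theorem exists_piece_index {N : ℕ} (hN : 0 < N) {t : ℝ} (ht : t ∈ Icc (0 : ℝ) 1) :
    ∃ k : ℕ, k < N ∧ (k : ℝ) / N ≤ t ∧ t ≤ ((k : ℝ) + 1) / N := by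
  have hN' : (0 : ℝ) < N := by exact_mod_cast hN
  rcases lt_or_ge (⌊t * N⌋₊) N with hk | hk
  · refine ⟨⌊t * N⌋₊, hk, ?_, ?_⟩
    · rw [div_le_iff₀ hN']
      exact Nat.floor_le (mul_nonneg ht.1 hN'.le)
    · rw [le_div_iff₀ hN']
      exact (Nat.lt_floor_add_one (t * N)).le
  · refine ⟨N - 1, Nat.sub_lt hN one_pos, ?_, ?_⟩
    · have h1 : (N : ℝ) ≤ t * N :=
        calc (N : ℝ) ≤ ⌊t * N⌋₊ := by exact_mod_cast hk
          _ ≤ t * N := Nat.floor_le (mul_nonneg ht.1 hN'.le)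
      rw [div_le_iff₀ hN']
      calc ((N - 1 : ℕ) : ℝ) ≤ N := by exact_mod_cast Nat.sub_le N 1
        _ ≤ t * N := h1
    · rw [le_div_iff₀ hN']
      have hc : ((N - 1 : ℕ) : ℝ) + 1 = N := by
        rw [Nat.cast_sub (Nat.one_le_of_lt hN)]
        push_cast
        ring
      rw [hc]
      nlinarith [ht.2]

/-- `segPoint b b t = b`. [folklore] -/
theorem segPoint_self (b : ℂ) (t : ℝ) : segPoint b b t = b := by
  unfold segPoint
  push_cast
  ring

/-! ### The pieces of the approximation and of the homotopy -/

section Pieces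

variable (ψ : ℂ → (Fin Z.n → ℂ)) (i₀ : Fin Z.n) (P : ℝ → (Fin Z.n → ℂ)) (N r : ℕ)

/-- The `r`-th piece of the approximation: the chart-straight segment from `P(r/N)` to
`P((r+1)/N)` in the chart `ψ` (coordinate `i₀`), parametrised by
`Real.smoothTransition (N t − r)` — constant `= P(r/N)` for `t ≤ r/N` and `= P((r+1)/N)` for
`t ≥ (r+1)/N`, and globally `C¹`. [folklore] -/
def smoothPiece (t : ℝ) : Fin Z.n → ℂ :=
  ψ (segPoint (P ((r : ℝ) / N) i₀) (P (((r : ℝ) + 1) / N) i₀)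
    (Real.smoothTransition ((N : ℝ) * t - r)))

/-- Clamping the parameter to `[r/N, (r+1)/N]`. [folklore] -/
def clampPiece (t : ℝ) : ℝ := max ((r : ℝ) / N) (min t (((r : ℝ) + 1) / N))

/-- The `r`-th piece of the homotopy: the straight-line homotopy, in the chart coordinate,
from `P` (clamped to `[r/N, (r+1)/N]`) to `smoothPiece`. [folklore] -/
def homPiece (q : ℝ × ℝ) : Fin Z.n → ℂ :=
  ψ (segPoint (P (clampPiece N r q.2) i₀) (smoothPiece ψ i₀ P N r q.2 i₀) (clamp01 q.1))

variable {ψ i₀ P N r} {T : Set ℂ}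

/-- `r/N ≤ (r+1)/N`. [folklore] -/
theorem div_le_succ_div (N r : ℕ) : (r : ℝ) / N ≤ ((r : ℝ) + 1) / N := by
  rcases Nat.eq_zero_or_pos N with h0 | hN
  · subst h0; simp
  · exact div_le_div_of_nonneg_right (by linarith) (by exact_mod_cast hN.le)

/-- The clamped parameter lies in `[r/N, (r+1)/N]`. [folklore] -/
theorem clampPiece_mem (t : ℝ) : clampPiece N r t ∈ Icc ((r : ℝ) / N) (((r : ℝ) + 1) / N) :=
  ⟨le_max_left _ _, max_le (div_le_succ_div N r) (min_le_right _ _)⟩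

/-- Clamping is the identity on `[r/N, (r+1)/N]`. [folklore] -/
theorem clampPiece_of_mem {t : ℝ} (ht : t ∈ Icc ((r : ℝ) / N) (((r : ℝ) + 1) / N)) :
    clampPiece N r t = t := by
  unfold clampPiece
  rw [min_eq_left ht.2, max_eq_right ht.1]

/-- Below the piece the clamp is `r/N`. [folklore] -/
theorem clampPiece_of_le {t : ℝ} (ht : t ≤ (r : ℝ) / N) : clampPiece N r t = (r : ℝ) / N := by
  unfold clampPiece
  exact max_eq_left (min_le_of_left_le ht)

/-- Above the piece the clamp is `(r+1)/N`. [folklore] -/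
theorem clampPiece_of_ge {t : ℝ} (ht : ((r : ℝ) + 1) / N ≤ t) :
    clampPiece N r t = ((r : ℝ) + 1) / N := by
  unfold clampPiece
  rw [min_eq_right ht, max_eq_right (div_le_succ_div N r)]

/-- The clamp is continuous. [folklore] -/
theorem continuous_clampPiece : Continuous (clampPiece N r) :=
  continuous_const.max (continuous_id.min continuous_const)

/-- The argument of `ψ` in `smoothPiece` lies in the (convex) chart disc. [folklore] -/
theorem smoothPiece_arg_mem (hTc : Convex ℝ T) (hb₀ : P ((r : ℝ) / N) i₀ ∈ T)
    (hb₁ : P (((r : ℝ) + 1) / N) i₀ ∈ T) (t : ℝ) :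
    segPoint (P ((r : ℝ) / N) i₀) (P (((r : ℝ) + 1) / N) i₀)
      (Real.smoothTransition ((N : ℝ) * t - r)) ∈ T :=
  segPoint_mem hTc hb₀ hb₁ ⟨Real.smoothTransition.nonneg _, Real.smoothTransition.le_one _⟩

/-- The piece lies on `Z`. [folklore] -/
theorem smoothPiece_mem (hTc : Convex ℝ T) (hψZ : MapsTo ψ T Z.points)
    (hb₀ : P ((r : ℝ) / N) i₀ ∈ T) (hb₁ : P (((r : ℝ) + 1) / N) i₀ ∈ T) (t : ℝ) :
    smoothPiece ψ i₀ P N r t ∈ Z.points :=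
  hψZ (smoothPiece_arg_mem hTc hb₀ hb₁ t)

/-- The chart coordinate of the piece. [folklore] -/
theorem smoothPiece_apply (hTc : Convex ℝ T) (hψi : ∀ w ∈ T, ψ w i₀ = w)
    (hb₀ : P ((r : ℝ) / N) i₀ ∈ T) (hb₁ : P (((r : ℝ) + 1) / N) i₀ ∈ T) (t : ℝ) :
    smoothPiece ψ i₀ P N r t i₀ = segPoint (P ((r : ℝ) / N) i₀) (P (((r : ℝ) + 1) / N) i₀)
      (Real.smoothTransition ((N : ℝ) * t - r)) :=
  hψi _ (smoothPiece_arg_mem hTc hb₀ hb₁ t)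

/-- The chart coordinate of the piece lies in the chart disc. [folklore] -/
theorem smoothPiece_apply_mem (hTc : Convex ℝ T) (hψi : ∀ w ∈ T, ψ w i₀ = w)
    (hb₀ : P ((r : ℝ) / N) i₀ ∈ T) (hb₁ : P (((r : ℝ) + 1) / N) i₀ ∈ T) (t : ℝ) :
    smoothPiece ψ i₀ P N r t i₀ ∈ T := by
  rw [smoothPiece_apply hTc hψi hb₀ hb₁]
  exact smoothPiece_arg_mem hTc hb₀ hb₁ t

/-- The piece is recovered from its chart coordinate. [folklore] -/
theorem psi_smoothPiece_apply (hTc : Convex ℝ T) (hψi : ∀ w ∈ T, ψ w i₀ = w)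
    (hb₀ : P ((r : ℝ) / N) i₀ ∈ T) (hb₁ : P (((r : ℝ) + 1) / N) i₀ ∈ T) (t : ℝ) :
    ψ (smoothPiece ψ i₀ P N r t i₀) = smoothPiece ψ i₀ P N r t := by
  rw [smoothPiece_apply hTc hψi hb₀ hb₁]
  rfl

/-- Before the piece: `smoothPiece t = P(r/N)` for `t ≤ r/N`. [folklore] -/
theorem smoothPiece_of_le (hN : 0 < N) (hP₀ : ψ (P ((r : ℝ) / N) i₀) = P ((r : ℝ) / N)) {t : ℝ}
    (ht : t ≤ (r : ℝ) / N) : smoothPiece ψ i₀ P N r t = P ((r : ℝ) / N) := by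
  have hN' : (0 : ℝ) < N := by exact_mod_cast hN
  have h : (N : ℝ) * t - r ≤ 0 := by
    have := (le_div_iff₀ hN').mp ht
    linarith [mul_comm (N : ℝ) t]
  unfold smoothPiece
  rw [Real.smoothTransition.zero_of_nonpos h, segPoint_zero, hP₀]

/-- After the piece: `smoothPiece t = P((r+1)/N)` for `t ≥ (r+1)/N`. [folklore] -/
theorem smoothPiece_of_ge (hN : 0 < N)
    (hP₁ : ψ (P (((r : ℝ) + 1) / N) i₀) = P (((r : ℝ) + 1) / N)) {t : ℝ}
    (ht : ((r : ℝ) + 1) / N ≤ t) : smoothPiece ψ i₀ P N r t = P (((r : ℝ) + 1) / N) := by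
  have hN' : (0 : ℝ) < N := by exact_mod_cast hN
  have h : 1 ≤ (N : ℝ) * t - r := by
    have := (div_le_iff₀ hN').mp ht
    linarith [mul_comm (N : ℝ) t]
  unfold smoothPiece
  rw [Real.smoothTransition.one_of_one_le h, segPoint_one, hP₁]

/-- The piece is globally `C¹` (the chart is real-`C¹` on the disc and the argument stays in
the disc). [folklore] -/
theorem contDiff_smoothPiece (hTc : Convex ℝ T) (hψ : AnalyticOnNhd ℂ ψ T)
    (hb₀ : P ((r : ℝ) / N) i₀ ∈ T) (hb₁ : P (((r : ℝ) + 1) / N) i₀ ∈ T) :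
    ContDiff ℝ 1 (smoothPiece ψ i₀ P N r) :=
  (contDiffOn_real_of_analyticOnNhd hψ).comp_contDiff
    ((contDiff_segPoint _ _).comp (Real.smoothTransition.contDiff.comp
      ((contDiff_const.mul contDiff_id).sub contDiff_const)))
    (fun t => smoothPiece_arg_mem hTc hb₀ hb₁ t)

/-- The piece is continuous. [folklore] -/
theorem continuous_smoothPiece (hTc : Convex ℝ T) (hψ : AnalyticOnNhd ℂ ψ T)
    (hb₀ : P ((r : ℝ) / N) i₀ ∈ T) (hb₁ : P (((r : ℝ) + 1) / N) i₀ ∈ T) :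
    Continuous (smoothPiece ψ i₀ P N r) :=
  (contDiff_smoothPiece hTc hψ hb₀ hb₁).continuous

/-- The argument of `ψ` in `homPiece` lies in the chart disc. [folklore] -/
theorem homPiece_arg_mem (hTc : Convex ℝ T) (hψi : ∀ w ∈ T, ψ w i₀ = w)
    (hP : ∀ u ∈ Icc ((r : ℝ) / N) (((r : ℝ) + 1) / N), P u i₀ ∈ T) (s t : ℝ) :
    segPoint (P (clampPiece N r t) i₀) (smoothPiece ψ i₀ P N r t i₀) (clamp01 s) ∈ T :=
  segPoint_mem hTc (hP _ (clampPiece_mem t))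
    (smoothPiece_apply_mem hTc hψi (hP _ ⟨le_rfl, div_le_succ_div N r⟩)
      (hP _ ⟨div_le_succ_div N r, le_rfl⟩) t) (clamp01_mem s)

/-- The homotopy piece lies on `Z`. [folklore] -/
theorem homPiece_mem (hTc : Convex ℝ T) (hψi : ∀ w ∈ T, ψ w i₀ = w) (hψZ : MapsTo ψ T Z.points)
    (hP : ∀ u ∈ Icc ((r : ℝ) / N) (((r : ℝ) + 1) / N), P u i₀ ∈ T) (q : ℝ × ℝ) :
    homPiece ψ i₀ P N r q ∈ Z.points :=
  hψZ (homPiece_arg_mem hTc hψi hP q.1 q.2)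

/-- The homotopy piece is continuous on `ℝ²`. [folklore] -/
theorem continuous_homPiece (hTc : Convex ℝ T) (hψ : AnalyticOnNhd ℂ ψ T)
    (hψi : ∀ w ∈ T, ψ w i₀ = w) (hPc : Continuous P)
    (hP : ∀ u ∈ Icc ((r : ℝ) / N) (((r : ℝ) + 1) / N), P u i₀ ∈ T) :
    Continuous (homPiece ψ i₀ P N r) := by
  have hb₀ : P ((r : ℝ) / N) i₀ ∈ T := hP _ ⟨le_rfl, div_le_succ_div N r⟩
  have hb₁ : P (((r : ℝ) + 1) / N) i₀ ∈ T := hP _ ⟨div_le_succ_div N r, le_rfl⟩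
  have h1 : Continuous fun q : ℝ × ℝ => P (clampPiece N r q.2) i₀ :=
    (continuous_apply i₀).comp (hPc.comp (continuous_clampPiece.comp continuous_snd))
  have h2 : Continuous fun q : ℝ × ℝ => smoothPiece ψ i₀ P N r q.2 i₀ :=
    (continuous_apply i₀).comp ((continuous_smoothPiece hTc hψ hb₀ hb₁).comp continuous_snd)
  have h3 : Continuous fun q : ℝ × ℝ => clamp01 q.1 := continuous_clamp01.comp continuous_fst
  refine hψ.continuousOn.comp_continuous ?_ (fun q => homPiece_arg_mem hTc hψi hP q.1 q.2)
  show Continuous fun q : ℝ × ℝ => (((1 - clamp01 q.1 : ℝ) : ℂ) * P (clampPiece N r q.2) i₀ +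
    ((clamp01 q.1 : ℝ) : ℂ) * smoothPiece ψ i₀ P N r q.2 i₀)
  exact ((Complex.continuous_ofReal.comp (continuous_const.sub h3)).mul h1).add
    ((Complex.continuous_ofReal.comp h3).mul h2)

/-- Before the piece the homotopy is constant `= P(r/N)`. [folklore] -/
theorem homPiece_of_le (hN : 0 < N) (hP₀ : ψ (P ((r : ℝ) / N) i₀) = P ((r : ℝ) / N)) {s t : ℝ}
    (ht : t ≤ (r : ℝ) / N) : homPiece ψ i₀ P N r (s, t) = P ((r : ℝ) / N) := by
  unfold homPiece
  rw [clampPiece_of_le ht, smoothPiece_of_le hN hP₀ ht, segPoint_self, hP₀]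

/-- After the piece the homotopy is constant `= P((r+1)/N)`. [folklore] -/
theorem homPiece_of_ge (hN : 0 < N)
    (hP₁ : ψ (P (((r : ℝ) + 1) / N) i₀) = P (((r : ℝ) + 1) / N)) {s t : ℝ}
    (ht : ((r : ℝ) + 1) / N ≤ t) : homPiece ψ i₀ P N r (s, t) = P (((r : ℝ) + 1) / N) := by
  unfold homPiece
  rw [clampPiece_of_ge ht, smoothPiece_of_ge hN hP₁ ht, segPoint_self, hP₁]

/-- At `s = 0` the homotopy piece is `P` (on the piece). [folklore] -/
theorem homPiece_zero_left (hP : ∀ u ∈ Icc ((r : ℝ) / N) (((r : ℝ) + 1) / N), ψ (P u i₀) = P u)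
    {t : ℝ} (ht : t ∈ Icc ((r : ℝ) / N) (((r : ℝ) + 1) / N)) :
    homPiece ψ i₀ P N r (0, t) = P t := by
  unfold homPiece
  rw [clamp01_of_mem ⟨le_rfl, zero_le_one⟩, segPoint_zero, clampPiece_of_mem ht, hP t ht]

/-- At `s = 1` the homotopy piece is the approximation piece. [folklore] -/
theorem homPiece_one_left (hTc : Convex ℝ T) (hψi : ∀ w ∈ T, ψ w i₀ = w)
    (hb₀ : P ((r : ℝ) / N) i₀ ∈ T) (hb₁ : P (((r : ℝ) + 1) / N) i₀ ∈ T) (t : ℝ) :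
    homPiece ψ i₀ P N r (1, t) = smoothPiece ψ i₀ P N r t := by
  unfold homPiece
  rw [clamp01_of_mem ⟨zero_le_one, le_rfl⟩, segPoint_one, psi_smoothPiece_apply hTc hψi hb₀ hb₁]

end Pieces

/-! ### The approximation theorem -/

/-- **Every continuous path on `Z(ℂ)` between algebraic points is homotopic to a `C¹` path.**
Let `Z` be a smooth affine curve over `ℚ̄` and `p : Path x y` a continuous path in the subspace
`Z(ℂ) ⊂ ℂⁿ` with `x, y ∈ Z(ℚ̄)`. Then there is a `C¹` path `γ` on `Z` with algebraic end points
(a `CurvePath`) and a path `q` agreeing with `γ` on `[0,1]` such that `p` and `q` are homotopic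
with fixed end points. In particular (with `span_single_sub_single_of_homotopic`) the symbol
`(Z, ω, γ)` of the class of `p` is well defined modulo the elementary relations. This is the
statement of §3.3.1 of the book that singular homology of `Z^an` relative to algebraic points is
computed by smooth chains. [cite: HuberWustholz2022, §3.3.1 (pp. 42–44)] -/
theorem exists_curvePath_of_path (hZ : Z.IsSmoothAffineCurve) {x y : Z.points} (p : Path x y)
    (hx : ∀ i, IsAlgebraic ℚ ((x : Fin Z.n → ℂ) i)) (hy : ∀ i, IsAlgebraic ℚ ((y : Fin Z.n → ℂ) i)) :
    ∃ (γ : CurvePath Z) (q : Path x y), (∀ t : I, γ.toFun t = q t) ∧ p.Homotopic q := by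
  classical
  have hI0 : (0 : ℝ) ∈ Icc (0 : ℝ) 1 := ⟨le_rfl, zero_le_one⟩
  have hI1 : (1 : ℝ) ∈ Icc (0 : ℝ) 1 := ⟨zero_le_one, le_rfl⟩
  -- the path as a continuous map on `ℝ`
  let P : ℝ → (Fin Z.n → ℂ) := fun t => ((p.extend t : Z.points) : Fin Z.n → ℂ)
  have hPc : Continuous P := continuous_subtype_val.comp p.continuous_extend
  have hPZ : ∀ t, P t ∈ Z.points := fun t => (p.extend t).2
  have hPt : ∀ {t : ℝ} (ht : t ∈ Icc (0 : ℝ) 1), P t = p ⟨t, ht⟩ := fun ht => by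
    show ((p.extend _ : Z.points) : Fin Z.n → ℂ) = _
    rw [Path.extend_apply p ht]
  have hP0 : P 0 = x := by show ((p.extend 0 : Z.points) : Fin Z.n → ℂ) = x; rw [p.extend_zero]
  have hP1 : P 1 = y := by show ((p.extend 1 : Z.points) : Fin Z.n → ℂ) = y; rw [p.extend_one]
  -- charts at the points of `Z`
  have hch : ∀ z, z ∈ Z.points → ∃ (i₀ : Fin Z.n) (ε : ℝ) (Ω : Set (Fin Z.n → ℂ))
      (ψ : ℂ → (Fin Z.n → ℂ)), 0 < ε ∧ IsOpen Ω ∧ z ∈ Ω ∧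
      AnalyticOnNhd ℂ ψ (ball (z i₀) ε) ∧
      (∀ z' ∈ Ω, z' ∈ Z.points → z' i₀ ∈ ball (z i₀) ε ∧ ψ (z' i₀) = z') ∧
      (∀ w ∈ ball (z i₀) ε, ψ w ∈ Ω ∧ ψ w ∈ Z.points ∧ ψ w i₀ = w) :=
    fun z hz => hZ.exists_localChart hz
  haveI : Nonempty (Fin Z.n) := ⟨⟨0, Nat.pos_of_ne_zero (n_ne_zero_of_mem hZ (hPZ 0))⟩⟩
  choose! ic εc Ωc ψc hεc hΩo hzΩ hψc h1c h2c using hch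
  -- Lebesgue number for the cover of `[0,1]` by the preimages of the chart domains
  have hcov : ∀ s : Icc (0 : ℝ) 1, ∃ U : Set ℝ, IsOpen U ∧ (s : ℝ) ∈ U ∧
      ∀ t ∈ U, P t ∈ Ωc (P s) := fun s =>
    ⟨P ⁻¹' Ωc (P s), (hΩo _ (hPZ s)).preimage hPc, hzΩ _ (hPZ s), fun _ ht => ht⟩
  choose U hUo hsU hU using hcov
  obtain ⟨δ, hδ, hleb⟩ := lebesgue_number_lemma_of_metric isCompact_Icc hUo
    (fun t ht => mem_iUnion.mpr ⟨⟨t, ht⟩, hsU ⟨t, ht⟩⟩)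
  obtain ⟨N₀, hN₀⟩ := exists_nat_one_div_lt hδ
  set N : ℕ := N₀ + 1 with hN
  have hNpos : 0 < N := Nat.succ_pos N₀
  have hN' : (0 : ℝ) < N := by exact_mod_cast hNpos
  have hNinv : 1 / (N : ℝ) < δ := by rw [hN]; exact_mod_cast hN₀
  have htI : ∀ r : ℕ, r ≤ N → (r : ℝ) / N ∈ Icc (0 : ℝ) 1 := fun r hr =>
    ⟨by positivity, (div_le_one hN').mpr (by exact_mod_cast hr)⟩
  -- the chart of the `r`-th piece
  have hidx : ∀ r : ℕ, r < N → ∃ s : Icc (0 : ℝ) 1,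
      ∀ t ∈ Icc ((r : ℝ) / N) (((r : ℝ) + 1) / N), P t ∈ Ωc (P s) := by
    intro r hr
    obtain ⟨s, hs⟩ := hleb ((r : ℝ) / N) (htI r hr.le)
    refine ⟨s, fun t ht => hU s t (hs ?_)⟩
    rw [mem_ball, Real.dist_eq, abs_lt]
    have h1 : t - r / N ≤ 1 / N := by have := ht.2; rw [add_div] at this; linarith
    exact ⟨by linarith [sub_nonneg.mpr ht.1], by linarith⟩
  choose! sc hsc using hidx
  -- chart data of piece `r`
  let c : ℕ → (Fin Z.n → ℂ) := fun r => P (sc r)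
  have hcZ : ∀ r, c r ∈ Z.points := fun r => hPZ _
  let i : ℕ → Fin Z.n := fun r => ic (c r)
  let T : ℕ → Set ℂ := fun r => ball (c r (i r)) (εc (c r))
  let ψ : ℕ → ℂ → (Fin Z.n → ℂ) := fun r => ψc (c r)
  have hTc : ∀ r, Convex ℝ (T r) := fun r => convex_ball _ _
  have hψa : ∀ r, AnalyticOnNhd ℂ (ψ r) (T r) := fun r => hψc _ (hcZ r)
  have hψi : ∀ r, ∀ w ∈ T r, ψ r w (i r) = w := fun r w hw => (h2c _ (hcZ r) w hw).2.2
  have hψZ : ∀ r, MapsTo (ψ r) (T r) Z.points := fun r w hw => (h2c _ (hcZ r) w hw).2.1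
  have hpc : ∀ r, r < N → ∀ t ∈ Icc ((r : ℝ) / N) (((r : ℝ) + 1) / N),
      P t (i r) ∈ T r ∧ ψ r (P t (i r)) = P t := fun r hr t ht =>
    h1c _ (hcZ r) _ (hsc r hr t ht) (hPZ t)
  have hleft : ∀ r, r < N → (r : ℝ) / N ∈ Icc ((r : ℝ) / N) (((r : ℝ) + 1) / N) := fun r _ =>
    ⟨le_rfl, div_le_succ_div N r⟩
  have hright : ∀ r, r < N → ((r : ℝ) + 1) / N ∈ Icc ((r : ℝ) / N) (((r : ℝ) + 1) / N) :=
    fun r _ => ⟨div_le_succ_div N r, le_rfl⟩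
  have hb₀ : ∀ r, r < N → P ((r : ℝ) / N) (i r) ∈ T r := fun r hr => (hpc r hr _ (hleft r hr)).1
  have hb₁ : ∀ r, r < N → P (((r : ℝ) + 1) / N) (i r) ∈ T r := fun r hr =>
    (hpc r hr _ (hright r hr)).1
  have hψP₀ : ∀ r, r < N → ψ r (P ((r : ℝ) / N) (i r)) = P ((r : ℝ) / N) := fun r hr =>
    (hpc r hr _ (hleft r hr)).2
  have hψP₁ : ∀ r, r < N → ψ r (P (((r : ℝ) + 1) / N) (i r)) = P (((r : ℝ) + 1) / N) :=
    fun r hr => (hpc r hr _ (hright r hr)).2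
  -- the approximation and the homotopy as telescoping sums
  let Pn : ℕ → (Fin Z.n → ℂ) := fun r => P ((r : ℝ) / N)
  have hPn0 : Pn 0 = P 0 := by show P (((0 : ℕ) : ℝ) / N) = P 0; rw [Nat.cast_zero, zero_div]
  have hcast : ∀ r : ℕ, (((r + 1 : ℕ) : ℝ)) / N = ((r : ℝ) + 1) / N := fun r => by push_cast; rfl
  let g : ℝ → (Fin Z.n → ℂ) := fun t =>
    P 0 + ∑ r ∈ Finset.range N, (smoothPiece (ψ r) (i r) P N r t - Pn r)
  let K : ℝ × ℝ → (Fin Z.n → ℂ) := fun q =>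
    P 0 + ∑ r ∈ Finset.range N, (homPiece (ψ r) (i r) P N r q - Pn r)
  -- evaluation on the `k`-th piece
  have hg_eval : ∀ k, k < N → ∀ t ∈ Icc ((k : ℝ) / N) (((k : ℝ) + 1) / N),
      g t = smoothPiece (ψ k) (i k) P N k t := by
    intro k hk t ht
    show P 0 + ∑ r ∈ Finset.range N, (smoothPiece (ψ r) (i r) P N r t - Pn r) = _
    rw [← hPn0]
    refine telescope_eval Pn (fun r => smoothPiece (ψ r) (i r) P N r t) hk
      (fun r hr => ?_) (fun r hkr hrN => ?_)
    · have hrN : r < N := hr.trans hk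
      show _ = P (((r + 1 : ℕ) : ℝ) / N)
      rw [hcast]
      refine smoothPiece_of_ge hNpos (hψP₁ r hrN) (le_trans ?_ ht.1)
      gcongr
      exact_mod_cast Nat.succ_le_of_lt hr
    · refine smoothPiece_of_le hNpos (hψP₀ r hrN) (le_trans ht.2 ?_)
      gcongr
      exact_mod_cast Nat.succ_le_of_lt hkr
  have hK_eval : ∀ k, k < N → ∀ s, ∀ t ∈ Icc ((k : ℝ) / N) (((k : ℝ) + 1) / N),
      K (s, t) = homPiece (ψ k) (i k) P N k (s, t) := by
    intro k hk s t ht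
    show P 0 + ∑ r ∈ Finset.range N, (homPiece (ψ r) (i r) P N r (s, t) - Pn r) = _
    rw [← hPn0]
    refine telescope_eval Pn (fun r => homPiece (ψ r) (i r) P N r (s, t)) hk
      (fun r hr => ?_) (fun r hkr hrN => ?_)
    · have hrN : r < N := hr.trans hk
      show _ = P (((r + 1 : ℕ) : ℝ) / N)
      rw [hcast]
      refine homPiece_of_ge hNpos (hψP₁ r hrN) (le_trans ?_ ht.1)
      gcongr
      exact_mod_cast Nat.succ_le_of_lt hr
    · refine homPiece_of_le hNpos (hψP₀ r hrN) (le_trans ht.2 ?_)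
      gcongr
      exact_mod_cast Nat.succ_le_of_lt hkr
  -- regularity
  have hgd : ContDiff ℝ 1 g :=
    contDiff_const.add (ContDiff.sum fun r hr =>
      (contDiff_smoothPiece (hTc r) (hψa r) (hb₀ r (Finset.mem_range.mp hr))
        (hb₁ r (Finset.mem_range.mp hr))).sub contDiff_const)
  have hKc : Continuous K :=
    continuous_const.add (continuous_finsetSum _ fun r hr =>
      (continuous_homPiece (hTc r) (hψa r) (hψi r) hPc
        (fun u hu => (hpc r (Finset.mem_range.mp hr) u hu).1)).sub continuous_const)
  -- values
  have hgZ : ∀ t ∈ Icc (0 : ℝ) 1, g t ∈ Z.points := fun t ht => by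
    obtain ⟨k, hk, hk1, hk2⟩ := exists_piece_index hNpos ht
    rw [hg_eval k hk t ⟨hk1, hk2⟩]
    exact smoothPiece_mem (hTc k) (hψZ k) (hb₀ k hk) (hb₁ k hk) t
  have hKZ : ∀ s, ∀ t ∈ Icc (0 : ℝ) 1, K (s, t) ∈ Z.points := fun s t ht => by
    obtain ⟨k, hk, hk1, hk2⟩ := exists_piece_index hNpos ht
    rw [hK_eval k hk s t ⟨hk1, hk2⟩]
    exact homPiece_mem (hTc k) (hψi k) (hψZ k) (fun u hu => (hpc k hk u hu).1) _
  have hg0 : g 0 = x := by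
    rw [hg_eval 0 hNpos 0 (by simp), ← hP0]
    have := smoothPiece_of_le (ψ := ψ 0) (i₀ := i 0) (P := P) (r := 0) hNpos
      (by simpa using hψP₀ 0 hNpos) (t := 0) (by simp)
    simpa using this
  have hg1 : g 1 = y := by
    have hk : N - 1 < N := Nat.sub_lt hNpos one_pos
    have hc1 : (((N - 1 : ℕ) : ℝ) + 1) / N = 1 := by
      rw [Nat.cast_sub (Nat.one_le_of_lt hNpos)]; push_cast
      rw [sub_add_cancel, div_self hN'.ne']
    have hmem : (1 : ℝ) ∈ Icc (((N - 1 : ℕ) : ℝ) / N) ((((N - 1 : ℕ) : ℝ) + 1) / N) :=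
      ⟨(div_le_one hN').mpr (by exact_mod_cast Nat.sub_le N 1), by rw [hc1]⟩
    rw [hg_eval (N - 1) hk 1 hmem, ← hP1]
    have := smoothPiece_of_ge (ψ := ψ (N - 1)) (i₀ := i (N - 1)) (P := P) (N := N) (r := N - 1)
      hNpos (hψP₁ (N - 1) hk) (t := 1) (by rw [hc1])
    rwa [hc1] at this
  have hK0t : ∀ t (ht : t ∈ Icc (0 : ℝ) 1), K (0, t) = P t := fun t ht => by
    obtain ⟨k, hk, hk1, hk2⟩ := exists_piece_index hNpos ht
    rw [hK_eval k hk 0 t ⟨hk1, hk2⟩]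
    exact homPiece_zero_left (fun u hu => (hpc k hk u hu).2) ⟨hk1, hk2⟩
  have hK1t : ∀ t (ht : t ∈ Icc (0 : ℝ) 1), K (1, t) = g t := fun t ht => by
    obtain ⟨k, hk, hk1, hk2⟩ := exists_piece_index hNpos ht
    rw [hK_eval k hk 1 t ⟨hk1, hk2⟩, hg_eval k hk t ⟨hk1, hk2⟩]
    exact homPiece_one_left (hTc k) (hψi k) (hb₀ k hk) (hb₁ k hk) t
  have hKs0 : ∀ s, K (s, 0) = x := fun s => by
    rw [hK_eval 0 hNpos s 0 (by simp), ← hP0]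
    have := homPiece_of_le (ψ := ψ 0) (i₀ := i 0) (P := P) (r := 0) hNpos
      (by simpa using hψP₀ 0 hNpos) (s := s) (t := 0) (by simp)
    simpa using this
  have hKs1 : ∀ s, K (s, 1) = y := fun s => by
    have hk : N - 1 < N := Nat.sub_lt hNpos one_pos
    have hc1 : (((N - 1 : ℕ) : ℝ) + 1) / N = 1 := by
      rw [Nat.cast_sub (Nat.one_le_of_lt hNpos)]; push_cast
      rw [sub_add_cancel, div_self hN'.ne']
    have hmem : (1 : ℝ) ∈ Icc (((N - 1 : ℕ) : ℝ) / N) ((((N - 1 : ℕ) : ℝ) + 1) / N) :=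
      ⟨(div_le_one hN').mpr (by exact_mod_cast Nat.sub_le N 1), by rw [hc1]⟩
    rw [hK_eval (N - 1) hk s 1 hmem, ← hP1]
    have := homPiece_of_ge (ψ := ψ (N - 1)) (i₀ := i (N - 1)) (P := P) (N := N) (r := N - 1)
      hNpos (hψP₁ (N - 1) hk) (s := s) (t := 1) (by rw [hc1])
    rwa [hc1] at this
  -- the `C¹` path, the path `q` and the homotopy
  let γ : CurvePath Z :=
    { toFun := g
      contDiffOn := hgd.contDiffOn
      mem_points := hgZ
      algebraic_zero := fun j => by rw [hg0]; exact hx j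
      algebraic_one := fun j => by rw [hg1]; exact hy j }
  let q : Path x y :=
    { toFun := fun t => ⟨g t, hgZ t t.2⟩
      continuous_toFun := (hgd.continuous.comp continuous_subtype_val).subtype_mk _
      source' := Subtype.ext hg0
      target' := Subtype.ext hg1 }
  let F : Path.Homotopy p q :=
    { toFun := fun st => ⟨K (st.1, st.2), hKZ _ _ st.2.2⟩
      continuous_toFun := (hKc.comp ((continuous_subtype_val.comp continuous_fst).prodMk
        (continuous_subtype_val.comp continuous_snd))).subtype_mk _
      map_zero_left := fun t => Subtype.ext (by
        show K (0, t) = (p t : Fin Z.n → ℂ)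
        rw [hK0t t t.2, hPt t.2])
      map_one_left := fun t => Subtype.ext (by
        show K (1, t) = g t
        exact hK1t t t.2)
      prop' := fun s t ht => by
        show (⟨K (s, t), _⟩ : Z.points) = p t
        rcases ht with ht | ht
        · rw [ht]
          exact Subtype.ext ((hKs0 s).trans (congrArg Subtype.val p.source.symm))
        · rw [Set.mem_singleton_iff] at ht
          rw [ht]
          exact Subtype.ext ((hKs1 s).trans (congrArg Subtype.val p.target.symm)) }
  exact ⟨γ, q, fun _ => rfl, ⟨F⟩⟩

/-! ### Consequences -/

/-- **Every continuous path between algebraic points has a symbol**: for `p : Path x y` in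
`Z(ℂ)` with `x, y ∈ Z(ℚ̄)` there is a `C¹` path `γ` homotopic to it, and the symbols of any two
such `C¹` paths agree modulo the elementary relations. [cite: HuberWustholz2022, §3.3.1 (pp. 42–44)] -/
theorem exists_curvePath_symbol_of_path (hZ : Z.IsSmoothAffineCurve)
    (ω : Fin Z.n → MvPolynomial (Fin Z.n) ℂ) (h : ∀ i, HasAlgCoeffs (ω i)) {x y : Z.points}
    (p : Path x y) (hx : ∀ i, IsAlgebraic ℚ ((x : Fin Z.n → ℂ) i))
    (hy : ∀ i, IsAlgebraic ℚ ((y : Fin Z.n → ℂ) i)) :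
    ∃ (γ : CurvePath Z) (q : Path x y), (∀ t : I, γ.toFun t = q t) ∧ p.Homotopic q ∧
      ∀ (γ' : CurvePath Z) (q' : Path x y), (∀ t : I, γ'.toFun t = q' t) → p.Homotopic q' →
        InSpan (Finsupp.single (⟨Z, hZ, ω, h, γ⟩ : PeriodSymbol) (1 : ℂ) -
          Finsupp.single ⟨Z, hZ, ω, h, γ'⟩ 1) := by
  obtain ⟨γ, q, hγq, hpq⟩ := exists_curvePath_of_path hZ p hx hy
  exact ⟨γ, q, hγq, hpq, fun γ' q' hγ' hpq' =>
    span_single_sub_single_of_homotopic hZ ω h q q' (hpq.symm.trans hpq') γ γ' hγq hγ'⟩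

/-- **Freely homotopic `C¹` loops have the same symbol.** Let `γ₀` be a `C¹` loop at `x` and
`γ₁` a `C¹` loop at `y` (algebraic base points), agreeing with `p₀ : Path x x`, `p₁ : Path y y`,
and let `d : Path x y` be ANY continuous path with `p₀ ≃ d ⋆ p₁ ⋆ d⁻¹` (i.e. the loops are
freely homotopic, the base point moving along `d`). Then `(Z, ω, γ₀) − (Z, ω, γ₁)` lies in the
span of the elementary relations (`exists_curvePath_of_path` replaces `d` by a `C¹` path `δ`,
then `span_single_sub_single_of_conjugate`). [cite: HuberWustholz2022, §3.3.1 (pp. 42–44)] -/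
theorem span_single_sub_single_of_freelyHomotopic (hZ : Z.IsSmoothAffineCurve)
    (ω : Fin Z.n → MvPolynomial (Fin Z.n) ℂ) (h : ∀ i, HasAlgCoeffs (ω i)) {x y : Z.points}
    (p₀ : Path x x) (p₁ : Path y y) (d : Path x y) (hp : p₀.Homotopic (d.trans (p₁.trans d.symm)))
    (γ₀ γ₁ : CurvePath Z) (hγ₀ : ∀ t : I, γ₀.toFun t = p₀ t)
    (hγ₁ : ∀ t : I, γ₁.toFun t = p₁ t) :
    InSpan (Finsupp.single (⟨Z, hZ, ω, h, γ₀⟩ : PeriodSymbol) (1 : ℂ) -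
        Finsupp.single ⟨Z, hZ, ω, h, γ₁⟩ 1) := by
  have hx : ∀ i, IsAlgebraic ℚ ((x : Fin Z.n → ℂ) i) := fun i => by
    rw [← toFun_zero_of_eq_path hγ₀]; exact γ₀.algebraic_zero i
  have hy : ∀ i, IsAlgebraic ℚ ((y : Fin Z.n → ℂ) i) := fun i => by
    rw [← toFun_zero_of_eq_path hγ₁]; exact γ₁.algebraic_zero i
  obtain ⟨δ, e, hδe, hde⟩ := exists_curvePath_of_path hZ d hx hy
  have he : (d.trans (p₁.trans d.symm)).Homotopic (e.trans (p₁.trans e.symm)) :=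
    hde.hcomp ((Path.Homotopic.refl p₁).hcomp hde.symm₂)
  exact span_single_sub_single_of_conjugate hZ ω h p₀ p₁ e (hp.trans he) γ₀ γ₁ δ hγ₀ hγ₁ hδe

end CurvePeriods

end Literature.NumberTheory.Transcendental

end
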